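import Summits.BirchSwinnertonDyer.BirchSwinnertonDyer.Theorems.KatoDescentTamePotSupersingularTameLowerPdescDeepShape
import Summits.BirchSwinnertonDyer.Rank1Residual.X11b.KrausMinimalityGeneralTwo
import HarnessLib

/-!
# Route `KatoDescentTamePotSupersingular` (rung K8-t′ = KT, cell `bsd-potss`), child crux `TameLowerIntrinsicNonCM`
# (item stmt-BirchSwinnertonDyer-19618), registered stub `stub_intr_residualNonCM` (REDUCIBLE disjunct) — RECORDS part 05:
# the 3 MIRROR classes `169812c`, `263934k`, `434070da` (`p = 3`; the first-descent residue of parts 01–04), read at their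
# `#Ш_an = 81` member through the subgroup-of-order-`27` road of `…TameLowerPdescDeepShape.lean` (p464069)
# (seat `bsd-potss-kt-pdesc`, ACCEL row (4); `--supports stmt-BirchSwinnertonDyer-19618 --as helper`; closes NOTHING class-wide)

PARTITION (D-0054, cell bsd-potss): EXCLUDED-DOMAIN non-CM additive `p` · B4 (t′) (`p = 3`, Kodaira `III`/`III*`, `e = 4`),
`r_an = 0`, INTRINSIC × {`E[3]` reducible} × MIRROR shape {`E` with a rational `3`-torsion point `S`, `#Ш_an(E) = 9`,
`Ш(E)[φ] = 0`} –φ→ {`E′ = E/⟨S⟩`, `E′[φ̂] ≅ μ₃`, `#Ш_an(E′) = 81`, `dim Ш(E′)[φ̂] = 2`}. Per class; class-wide the stub is Kato's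
Conj. 12.10 lower half (OPEN). HONEST FRAMING: BSD is not proved by any of this; THEOREMS ONLY; nothing is booked here.

Each record instantiates `KTPdesc.missingLowerBoundAt_of_isIsogenous_ainvs_of_subgroupCube` on the literal Cremona model `W₀`
of the `#Ш_an = 81` member `E′` with `G = ℤ/9 × ℤ/3` (`Nat.card G = 27`): `MissingLowerBoundAt W 3` at EVERY globally minimal
`W ∼_ℚ W₀`. DECIDED IN THE KERNEL: `Δ ≠ 0`, global minimality (Kraus support criterion), `Nat.card (ℤ/9 × ℤ/3) = 3³`.
DISPLAYED binders: PUBLISHED `hCT`, `hCassels`, `hGZK`, `hmod`; per class `hr` (`r_an = 0`), `hs`/`hv` (`#Ш_an(W₀) = 81`,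
`ord₃ = 4`) and the certificate slot `f : ℤ/9 × ℤ/3 →+ Ш(W₀)`, `hf : Injective f`, whose EVIDENCE (quoted per record) is the
sha-2 mirror recipe run by this seat: (C1) kit j257757 (engines 2χ/2cft, EXACT, agree): `Ш(E)[φ] = 0` (s_φ = Mordell–Weil part)
and `dim Ш(E′)[φ̂] = ŝ − q_φ̂ = 2`, hence `Ш(E′)[3] = Ш(E′)[φ̂]` (`φ(φ̂x) = 3x = 0 ⇒ φ̂x ∈ Ш(E)[φ] = 0`) of dimension exactly
`2`; (C2) kit **j258905** (engine C `ctpc.gp` sha256 9c3e313b…, b2b-bsdres-sha-2 gen 3, UNMODIFIED; basis of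
`S^(φ̂)(E′/ℚ) ⊂ ℚ^×/ℚ^{×3}` from `selgens.gp` = engine 2χ's side-1 internals, re-derived identically by engine C from its own
sampled local images): the Cassels–Tate pairing on `V = S^(φ̂)(E′/ℚ)/δ(E(ℚ))` (`dim V = 2`) is IDENTICALLY ZERO — verdict
`DEGENERATE(rank 0/2)`, 0 hard flags; (T) CT non-degenerate alternating on the finite `Ш(E′)` (GZK) ⇒ `Ш(E′)[3] ⊆ 3Ш(E′)` ⇒
`Ш(E′)[9] ≅ (ℤ/9)² ⊇ ℤ/9 × ℤ/3`. This is the BSD-predicted verdict (`Ш(E′) ≅ (ℤ/9)²`); a `NONDEG` verdict would have been an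
anomaly (`#Ш(E′)[3^∞] = 9` against `#Ш_an = 81`); none occurred (K9 precedent: 29/29 wild mirror classes, K9-DESC3-WITNESS §6).

References: [SilvermanAEC2009] Thm. X.4.14, VII.1 Rem. 1.1; [Kraus1989] Prop. 1–2; [MilneADT2006] Thm. I.7.3; [Miller2011LMS] Def. 1.1;
[Cremona2006] Table 1; M. van Beek–T. Fisher, Acta Arith. 185 (2018) 367–396; [Kato2004Asterisque] Conj. 12.10 (p. 224).
-/

set_option autoImplicit false
set_option linter.dupNamespace false

noncomputable section

open scoped Classical

open WeierstrassCurve Literature.NumberTheory.EllipticCurves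
  Literature.NumberTheory.EllipticCurves.Rank1Residual
  Literature.NumberTheory.EllipticCurves.Rank1Residual.Typed
  Summit.BirchSwinnertonDyer.Rank1Residual

namespace Summit.BirchSwinnertonDyer.BirchSwinnertonDyer.Theorems

/-- **L₀ `MissingLowerBoundAt · 3` on the intrinsic (t′) MIRROR class `169812c`** (`E[3]` reducible, image `B`; `N =
169812 = 2^2·3^2·53·89`; Kodaira type `III` at `3` (`e = 4`); members: 169812c1 `#Ш_an = 9`, `#tors = 3`, `∏c =
108`, 169812c2 `#Ш_an = 81`, `#tors = 1`, `∏c = 4`). Mirror pair: `E = 169812c1` (rational `3`-torsion point `S =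
[7500, 500002]`) –φ→ `E′ = 169812c2` (`E′[φ̂] ≅ μ₃`). Certificate member `W₀ = 169812c2 = [0, 0, 0, -1518755400,
-22781371500108]` (Cremona `allbsd`: `r_an = 0`, `#Ш_an(W₀) = 81`, `ord₃ = 4`). Kernel-decided: `Δ(W₀) ≠ 0`, global
minimality (support of `Δ` = `[(2, 2, 8), (3, 2, 9), (53, 1, 2), (89, 1, 1)]` as `(q, v_q N, v_q Δ)`;
Silverman/Kraus disjunct per prime: 2:a, 3:a, 53:a, 89:a), `Nat.card (ℤ/9 × ℤ/3) = 27`. Binders: PUBLISHED `hCT`,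
`hCassels`, `hGZK`, `hmod`; per class `hr`, `hs`/`hv`, the slot `f : ℤ/9 × ℤ/3 →+ Ш(W₀)` injective — EVIDENCE: (C1)
kit j257757 (2χ/2cft agree, exact) row `169812c1`: `(s_φ, ŝ, m, excess) = (0, 3, 1, 2)`, MW split `(q_φ, q_φ̂) = (0,
1)` ⇒ `dim Ш(169812c1)[φ] = 0` (exactly) and `dim Ш(W₀)[φ̂] = 2` ⇒ `Ш(W₀)[3] = Ш(W₀)[φ̂] ≅ (ℤ/3)²`; (C2) kit j258905
(engine C `ctpc.gp` 9c3e313b…, unmodified) case `169812c1@3`: `S^(φ̂)(W₀/ℚ)` basis `[2, 53, 89]` (dim 3, re-derived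
by engine C = 3), `V`-basis `[2, 53]`, Cassels–Tate matrix on `V` = `[0, 0; 0, 0]` (full `[0, 0, 0; 0, 0, 0; 0, 0,
0]`), verdict `DEGENERATE(rank 0/2)+softflags(1)` (soft flag: no second local point for an independence check at `q
= 3`; the pre-registered precision/seed re-run kit j258946, `JOB_PREC=160`/`JOB_SEED=7`: `DEGENERATE(rank 0/2)`, 0
flags, identical matrices) ⇒ `Ш(W₀)[3] ⊆ 3Ш(W₀)` ⇒ `Ш(W₀)[9] ≅ (ℤ/9)² ⊇ ℤ/9 × ℤ/3`; `hiso`: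
the Cremona class 169812c (2 curves). Per class; nothing booked. [cite: SilvermanAEC2009, Thm. X.4.14 and VII.1
Remark 1.1] [cite: Miller2011LMS, §1 and Def. 1.1] [cite: Cremona2006, Table 1 (Cremona label 169812c2)] -/
theorem KTPdesc.lower3_cube_169812c2 (hCT : exists_casselsTate_pairing (K := ℚ))
    (hCassels : bsdRHS_eq_of_isIsogenous) (hGZK : rank_eq_analyticRank_of_analyticRank_le_one)
    (hmod : hasEntireLFunction_rat) (W₀ : WeierstrassCurve ℚ) (hW₀ : W₀ = ⟨0, 0, 0, -1518755400, -22781371500108⟩)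
    (hr : W₀.analyticRank = 0) {s : ℚ} (hs : shaAn W₀ = (s : ℂ)) (hv : padicValRat 3 s ≤ 4)
    (f : (ZMod 9 × ZMod 3) →+ W₀.sha) (hf : Function.Injective f)
    (W : WeierstrassCurve ℚ) [W.IsElliptic] [W.IsGloballyMinimal] (hiso : IsIsogenous W W₀) :
    MissingLowerBoundAt W 3 := by
  subst hW₀
  haveI : Fact (Nat.Prime 3) := ⟨by norm_num⟩
  have hG : Nat.card (ZMod 9 × ZMod 3) = 3 ^ 3 := by
    rw [Nat.card_prod, Nat.card_zmod, Nat.card_zmod]; norm_num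
  exact KTPdesc.missingLowerBoundAt_of_isIsogenous_ainvs_of_subgroupCube hCT hCassels hGZK hmod
    0 0 0 (-1518755400) (-22781371500108)
    (X11b.isGloballyMinimal_of_krausCriterion_support 0 0 0 (-1518755400) (-22781371500108)
      [(2, 2, 8), (3, 2, 9), (53, 1, 2), (89, 1, 1)]
      (by intro t ht; simp only [List.mem_cons, List.not_mem_nil, or_false] at ht; rcases ht with rfl | rfl | rfl | rfl <;> norm_num)
      (by decide +kernel) (by decide +kernel))
    (by decide +kernel) 3 hr hs hv hG f hf W hiso

/-- **L₀ `MissingLowerBoundAt · 3` on the intrinsic (t′) MIRROR class `263934k`** (`E[3]` reducible, image `B`; `N =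
263934 = 2·3^2·11·31·43`; Kodaira type `III` at `3` (`e = 4`); members: 263934k1 `#Ш_an = 9`, `#tors = 6`, `∏c =
216`, 263934k2 `#Ш_an = 9`, `#tors = 6`, `∏c = 216`, 263934k3 `#Ш_an = 81`, `#tors = 2`, `∏c = 8`, 263934k4 `#Ш_an =
81`, `#tors = 2`, `∏c = 8`). Mirror pair: `E = 263934k1` (rational `3`-torsion point `S = [5419, 312545]`) –φ→ `E′ =
263934k3` (`E′[φ̂] ≅ μ₃`). Certificate member `W₀ = 263934k3 = [1, -1, 0, -811597632, -8899174346752]` (Cremona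
`allbsd`: `r_an = 0`, `#Ш_an(W₀) = 81`, `ord₃ = 4`). Kernel-decided: `Δ(W₀) ≠ 0`, global minimality (support of `Δ`
= `[(2, 1, 42), (3, 2, 9), (11, 1, 1), (31, 1, 1), (43, 1, 2)]` as `(q, v_q N, v_q Δ)`; Silverman/Kraus disjunct per
prime: 2:a, 3:a, 11:a, 31:a, 43:a), `Nat.card (ℤ/9 × ℤ/3) = 27`. Binders: PUBLISHED `hCT`, `hCassels`, `hGZK`,
`hmod`; per class `hr`, `hs`/`hv`, the slot `f : ℤ/9 × ℤ/3 →+ Ш(W₀)` injective — EVIDENCE: (C1) kit j257757 (2χ/2cft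
agree, exact) row `263934k1`: `(s_φ, ŝ, m, excess) = (0, 3, 1, 2)`, MW split `(q_φ, q_φ̂) = (0, 1)` ⇒ `dim
Ш(263934k1)[φ] = 0` (exactly) and `dim Ш(W₀)[φ̂] = 2` ⇒ `Ш(W₀)[3] = Ш(W₀)[φ̂] ≅ (ℤ/3)²`; (C2) kit j258905 (engine C
`ctpc.gp` 9c3e313b…, unmodified) case `263934k1@3`: `S^(φ̂)(W₀/ℚ)` basis `[11, 31, 43]` (dim 3, re-derived by engine
C = 3), `V`-basis `[11, 31]`, Cassels–Tate matrix on `V` = `[0, 0; 0, 0]` (full `[0, 0, 0; 0, 0, 0; 0, 0, 0]`),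
verdict `DEGENERATE(rank 0/2)` ⇒ `Ш(W₀)[3] ⊆ 3Ш(W₀)` ⇒ `Ш(W₀)[9] ≅ (ℤ/9)² ⊇ ℤ/9 × ℤ/3`; `hiso`: the Cremona class
263934k (4 curves). Per class; nothing booked. [cite: SilvermanAEC2009, Thm. X.4.14 and VII.1 Remark 1.1] [cite:
Miller2011LMS, §1 and Def. 1.1] [cite: Cremona2006, Table 1 (Cremona label 263934k3)] -/
theorem KTPdesc.lower3_cube_263934k3 (hCT : exists_casselsTate_pairing (K := ℚ))
    (hCassels : bsdRHS_eq_of_isIsogenous) (hGZK : rank_eq_analyticRank_of_analyticRank_le_one)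
    (hmod : hasEntireLFunction_rat) (W₀ : WeierstrassCurve ℚ) (hW₀ : W₀ = ⟨1, -1, 0, -811597632, -8899174346752⟩)
    (hr : W₀.analyticRank = 0) {s : ℚ} (hs : shaAn W₀ = (s : ℂ)) (hv : padicValRat 3 s ≤ 4)
    (f : (ZMod 9 × ZMod 3) →+ W₀.sha) (hf : Function.Injective f)
    (W : WeierstrassCurve ℚ) [W.IsElliptic] [W.IsGloballyMinimal] (hiso : IsIsogenous W W₀) :
    MissingLowerBoundAt W 3 := by
  subst hW₀
  haveI : Fact (Nat.Prime 3) := ⟨by norm_num⟩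
  have hG : Nat.card (ZMod 9 × ZMod 3) = 3 ^ 3 := by
    rw [Nat.card_prod, Nat.card_zmod, Nat.card_zmod]; norm_num
  exact KTPdesc.missingLowerBoundAt_of_isIsogenous_ainvs_of_subgroupCube hCT hCassels hGZK hmod
    1 (-1) 0 (-811597632) (-8899174346752)
    (X11b.isGloballyMinimal_of_krausCriterion_support 1 (-1) 0 (-811597632) (-8899174346752)
      [(2, 1, 42), (3, 2, 9), (11, 1, 1), (31, 1, 1), (43, 1, 2)]
      (by intro t ht; simp only [List.mem_cons, List.not_mem_nil, or_false] at ht; rcases ht with rfl | rfl | rfl | rfl | rfl <;> norm_num)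
      (by decide +kernel) (by decide +kernel))
    (by decide +kernel) 3 hr hs hv hG f hf W hiso

/-- **L₀ `MissingLowerBoundAt · 3` on the intrinsic (t′) MIRROR class `434070da`** (`E[3]` reducible, image `B`; `N
= 434070 = 2·3^2·5·7·13·53`; Kodaira type `III` at `3` (`e = 4`); members: 434070da1 `#Ш_an = 9`, `#tors = 6`, `∏c =
4320`, 434070da2 `#Ш_an = 9`, `#tors = 6`, `∏c = 8640`, 434070da3 `#Ш_an = 81`, `#tors = 2`, `∏c = 160`, 434070da4
`#Ш_an = 81`, `#tors = 2`, `∏c = 320`). Mirror pair: `E = 434070da1` (rational `3`-torsion point `S = [869947,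
-620667678]`) –φ→ `E′ = 434070da3` (`E′[φ̂] ≅ μ₃`). Certificate member `W₀ = 434070da3 = [1, -1, 1, -20306168843123,
-35220055317122282669]` (Cremona `allbsd`: `r_an = 0`, `#Ш_an(W₀) = 81`, `ord₃ = 4`). Kernel-decided: `Δ(W₀) ≠ 0`,
global minimality (support of `Δ` = `[(2, 1, 20), (3, 2, 9), (5, 1, 15), (7, 1, 1), (13, 1, 2), (53, 1, 6)]` as `(q,
v_q N, v_q Δ)`; Silverman/Kraus disjunct per prime: 2:a, 3:a, 5:a, 7:a, 13:a, 53:a), `Nat.card (ℤ/9 × ℤ/3) = 27`.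
Binders: PUBLISHED `hCT`, `hCassels`, `hGZK`, `hmod`; per class `hr`, `hs`/`hv`, the slot `f : ℤ/9 × ℤ/3 →+ Ш(W₀)`
injective — EVIDENCE: (C1) kit j257757 (2χ/2cft agree, exact) row `434070da1`: `(s_φ, ŝ, m, excess) = (0, 3, 1, 2)`,
MW split `(q_φ, q_φ̂) = (0, 1)` ⇒ `dim Ш(434070da1)[φ] = 0` (exactly) and `dim Ш(W₀)[φ̂] = 2` ⇒ `Ш(W₀)[3] =
Ш(W₀)[φ̂] ≅ (ℤ/3)²`; (C2) kit j258905 (engine C `ctpc.gp` 9c3e313b…, unmodified) case `434070da1@3`: `S^(φ̂)(W₀/ℚ)`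
basis `[2, 7, 13]` (dim 3, re-derived by engine C = 3), `V`-basis `[2, 7]`, Cassels–Tate matrix on `V` = `[0, 0; 0,
0]` (full `[0, 0, 0; 0, 0, 0; 0, 0, 0]`), verdict `DEGENERATE(rank 0/2)` ⇒ `Ш(W₀)[3] ⊆ 3Ш(W₀)` ⇒ `Ш(W₀)[9] ≅ (ℤ/9)²
⊇ ℤ/9 × ℤ/3`; `hiso`: the Cremona class 434070da (4 curves). Per class; nothing booked. [cite: SilvermanAEC2009,
Thm. X.4.14 and VII.1 Remark 1.1] [cite: Miller2011LMS, §1 and Def. 1.1] [cite: Cremona2006, Table 1 (Cremona label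
434070da3)] -/
theorem KTPdesc.lower3_cube_434070da3 (hCT : exists_casselsTate_pairing (K := ℚ))
    (hCassels : bsdRHS_eq_of_isIsogenous) (hGZK : rank_eq_analyticRank_of_analyticRank_le_one)
    (hmod : hasEntireLFunction_rat) (W₀ : WeierstrassCurve ℚ) (hW₀ : W₀ = ⟨1, -1, 1, -20306168843123, -35220055317122282669⟩)
    (hr : W₀.analyticRank = 0) {s : ℚ} (hs : shaAn W₀ = (s : ℂ)) (hv : padicValRat 3 s ≤ 4)
    (f : (ZMod 9 × ZMod 3) →+ W₀.sha) (hf : Function.Injective f)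
    (W : WeierstrassCurve ℚ) [W.IsElliptic] [W.IsGloballyMinimal] (hiso : IsIsogenous W W₀) :
    MissingLowerBoundAt W 3 := by
  subst hW₀
  haveI : Fact (Nat.Prime 3) := ⟨by norm_num⟩
  have hG : Nat.card (ZMod 9 × ZMod 3) = 3 ^ 3 := by
    rw [Nat.card_prod, Nat.card_zmod, Nat.card_zmod]; norm_num
  exact KTPdesc.missingLowerBoundAt_of_isIsogenous_ainvs_of_subgroupCube hCT hCassels hGZK hmod
    1 (-1) 1 (-20306168843123) (-35220055317122282669)
    (X11b.isGloballyMinimal_of_krausCriterion_support 1 (-1) 1 (-20306168843123) (-35220055317122282669)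
      [(2, 1, 20), (3, 2, 9), (5, 1, 15), (7, 1, 1), (13, 1, 2), (53, 1, 6)]
      (by intro t ht; simp only [List.mem_cons, List.not_mem_nil, or_false] at ht; rcases ht with rfl | rfl | rfl | rfl | rfl | rfl <;> norm_num)
      (by decide +kernel) (by decide +kernel))
    (by decide +kernel) 3 hr hs hv hG f hf W hiso

end Summit.BirchSwinnertonDyer.BirchSwinnertonDyer.Theorems

end
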